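import Summits.AtomisticToContinuum.BoseEinsteinCondensation.Theses.BECModePrice
import Summits.AtomisticToContinuum.BoseEinsteinCondensation.Theorems.BECModePriceModePriceIntegrableGNotchInfrastructure
import Literature.MathematicalPhysics.QuantumManyBody.PeriodicBoseGasFracEnergy
import HarnessLib

/-!
# Crux `ModePriceIntegrable` (stmt-AtomisticToContinuum-18512) — certified normal form

Line `Sketch` of the crux chain, lead cycle c2 (2026-08-17). The crux (route BECModePrice, the
single-mode softening price SMS) reads: for every repulsive finite-range integrable `v` there are
`C, ρ₀ > 0` with, for `0 < ρ < ρ₀`, eventually in `N`, for all modes `p ≠ 0` and ALL periodic trial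
states `Ψ` on the torus of side `L = (N/ρ)^{1/3}`,
`E₀^per + ½|2πp/L|² n_p(Ψ) ≤ ⟨Ψ,HΨ⟩ + Cρ`.

`modePriceIntegrable_iff_softenedNearMin` (registered side stub of the line) certifies in the
kernel the diagnosis recorded by the leads of line `Sketch`: the crux is EQUIVALENT (same
quantifier block, constant `C ↦ 2C` each way) to the existence, for every mode `p ≠ 0`, of ONE
periodic state `Φ` which
* is a `Cρ`-near-minimiser of the SOFTENED functional `Ψ ↦ ⟨Ψ,HΨ⟩ - ½|k|²n_p(Ψ)` (written
  additively in `ℝ≥0∞`: `E Φ + s·n Ψ ≤ E Ψ + s·n Φ + Cρ` for all `Ψ`, `s = ½|2πp/L|²`), and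
* has half-price occupation `½|k|² n_p(Φ) ≤ Cρ`.
So SMS is exactly an `N`-uniform, mode-uniform `O(ρ)` bound on the kinetic half-price carried by
one near-ground state of `H - ½|k|²a_k†a_k` — the statement type of the line's open stub O
(`stub_softenedGNotchedOccupation`, the same assertion for the g-notched Hamiltonian), which is why
O is crux-sized. Direction `→` takes for `Φ` a `Cρ`-near-minimiser of `⟨·,H·⟩` itself (it exists:
the constant state has finite energy for integrable `v`, `GNotch.periodicEnergy_constState_ne_top`),
so the crux is also equivalent to the same statement with `Φ` a near-GROUND state; direction `←`
is the chord of the landed stub P (`stub_price_of_softenedOccupation`) with a finite slack.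
Abstract bookkeeping: `sms_of_softenedNearMin`, `softenedNearMin_of_sms` (any type, any
`ℝ≥0∞`-valued `E, n`). All `[folklore]`.
-/

noncomputable section

open MeasureTheory Filter
open scoped ENNReal NNReal

namespace Summit.AtomisticToContinuum.BoseEinsteinCondensation.Theorems

open Literature.MathematicalPhysics.QuantumManyBody.BoseGas
open Summit.AtomisticToContinuum.BoseEinsteinCondensation.Theses.BECModePrice

/-- **Softened near-minimiser ⇒ SMS.** If `Φ` is a `B₁`-near-minimiser of the softened functional
`E - s·n` (additive form) with `s·n Φ ≤ B₂`, then `inf E + s·n Ψ ≤ E Ψ + (B₁ + B₂)` for all `Ψ`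
(the chord of stub P with a finite slack). [folklore] -/
theorem sms_of_softenedNearMin {S : Type*} (E n : S → ℝ≥0∞) (s B₁ B₂ : ℝ≥0∞) (Φ : S)
    (hΦ : ∀ Ψ, E Φ + s * n Ψ ≤ E Ψ + s * n Φ + B₁) (hn : s * n Φ ≤ B₂) :
    ∀ Ψ, (⨅ Ψ', E Ψ') + s * n Ψ ≤ E Ψ + (B₁ + B₂) := by
  intro Ψ
  calc (⨅ Ψ', E Ψ') + s * n Ψ ≤ E Φ + s * n Ψ := add_le_add (iInf_le _ Φ) le_rfl
    _ ≤ E Ψ + s * n Φ + B₁ := hΦ Ψ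
    _ ≤ E Ψ + B₂ + B₁ := by gcongr
    _ = E Ψ + (B₁ + B₂) := by rw [add_assoc, add_comm B₂ B₁]

/-- **SMS ⇒ softened near-minimiser.** If `inf E + s·n Ψ ≤ E Ψ + B` for all `Ψ` (SMS with budget
`B`), `inf E` is finite and `Φ` is a `B'`-near-minimiser of `E`, then `Φ` is a `(B + B')`-near-
minimiser of the softened functional (additive form) and `s·n Φ ≤ B + B'`. [folklore] -/
theorem softenedNearMin_of_sms {S : Type*} (E n : S → ℝ≥0∞) (s B B' : ℝ≥0∞) (Φ : S)
    (hinf : (⨅ Ψ, E Ψ) ≠ ⊤) (hsms : ∀ Ψ, (⨅ Ψ', E Ψ') + s * n Ψ ≤ E Ψ + B)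
    (hΦ : E Φ ≤ (⨅ Ψ, E Ψ) + B') :
    (∀ Ψ, E Φ + s * n Ψ ≤ E Ψ + s * n Φ + (B + B')) ∧ s * n Φ ≤ B + B' := by
  constructor
  · intro Ψ
    calc E Φ + s * n Ψ ≤ (⨅ Ψ', E Ψ') + B' + s * n Ψ := by gcongr
      _ = ((⨅ Ψ', E Ψ') + s * n Ψ) + B' := by ring
      _ ≤ (E Ψ + B) + B' := add_le_add (hsms Ψ) le_rfl
      _ = E Ψ + (B + B') := by ring
      _ ≤ E Ψ + s * n Φ + (B + B') := by gcongr; exact le_self_add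
  · have h2 : (⨅ Ψ', E Ψ') + s * n Φ ≤ (⨅ Ψ', E Ψ') + (B + B') :=
      calc (⨅ Ψ', E Ψ') + s * n Φ ≤ E Φ + B := hsms Φ
        _ ≤ (⨅ Ψ, E Ψ) + B' + B := by gcongr
        _ = (⨅ Ψ, E Ψ) + (B + B') := by ring
    exact (ENNReal.add_le_add_iff_left hinf).1 h2

/-- **Certified normal form of the crux** (registered side stub of line `Sketch`):
`ModePriceIntegrable` holds iff for every admissible integrable `v` there are `C, ρ₀ > 0` such that
for `0 < ρ < ρ₀`, eventually in `N`, for every mode `p ≠ 0` SOME periodic state `Φ` on the torus of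
side `L = (N/ρ)^{1/3}` is a `Cρ`-near-minimiser of the softened functional
`⟨Ψ,HΨ⟩ - ½|2πp/L|² n_p(Ψ)` (additive form) with half-price occupation `½|2πp/L|² n_p(Φ) ≤ Cρ`.
(`→`: `Φ` = a `Cρ`-near-minimiser of the energy, constant `2C`; `←`: chord, constant `2C`.)
[folklore] -/
theorem modePriceIntegrable_iff_softenedNearMin : open MeasureTheory Literature.MathematicalPhysics.QuantumManyBody.BoseGas Summit.AtomisticToContinuum.BoseEinsteinCondensation.Theses.BECModePrice in ModePriceIntegrable ↔ (∀ v : ℝ → ENNReal, IsRepulsiveFiniteRange v → (∫⁻ x : EuclideanSpace ℝ (Fin 3), v ‖x‖) ≠ ⊤ → ∃ C : ℝ, 0 < C ∧ ∃ ρ₀ : ℝ, 0 < ρ₀ ∧ ∀ ρ : ℝ, 0 < ρ → ρ < ρ₀ → ∀ᶠ N : ℕ in Filter.atTop, ∀ p : Fin 3 → ℤ, p ≠ 0 → ∃ Φ : PeriodicTrialState N (sideLength ρ N), (∀ Ψ : PeriodicTrialState N (sideLength ρ N), periodicEnergy v Φ + 2⁻¹ * fracDispersion 2 (sideLength ρ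 N) p * cellOccupation N (sideLength ρ N) (planeWaveMode (sideLength ρ N) p) Ψ.ψ ≤ periodicEnergy v Ψ + 2⁻¹ * fracDispersion 2 (sideLength ρ N) p * cellOccupation N (sideLength ρ N) (planeWaveMode (sideLength ρ N) p) Φ.ψ + ENNReal.ofReal (C * ρ)) ∧ 2⁻¹ * fracDispersion 2 (sideLength ρ N) p * cellOccupation N (sideLength ρ N) (planeWaveMode (sideLength ρ N) p) Φ.ψ ≤ ENNReal.ofReal (C * ρ)) := by
  constructor
  · intro h v hv hint
    obtain ⟨C, hC, ρ₀, hρ₀, hh⟩ := h v hv hint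
    refine ⟨C + C, by positivity, ρ₀, hρ₀, fun ρ hρ hρ' => ?_⟩
    filter_upwards [hh ρ hρ hρ', eventually_ge_atTop 1] with N hN hN1
    intro p hp
    have hNr : (0 : ℝ) < N := Nat.cast_pos.2 hN1
    set L : ℝ := sideLength ρ N with hL
    have hLpos : 0 < L := Real.rpow_pos_of_pos (div_pos hNr hρ) _
    set s : ℝ≥0∞ := 2⁻¹ * fracDispersion 2 L p with hs
    set n : PeriodicTrialState N L → ℝ≥0∞ := fun Φ => cellOccupation N L (planeWaveMode L p) Φ.ψ
      with hn
    have hCρ : (0 : ℝ≥0∞) < ENNReal.ofReal (C * ρ) := ENNReal.ofReal_pos.2 (mul_pos hC hρ)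
    have hinf : (⨅ Ψ : PeriodicTrialState N L, periodicEnergy v Ψ) ≠ ⊤ :=
      ne_top_of_le_ne_top (GNotch.periodicEnergy_constState_ne_top hv.1 hint N hLpos)
        (iInf_le _ _)
    haveI : Nonempty (PeriodicTrialState N L) := ⟨GNotch.constState N hLpos⟩
    obtain ⟨Φ, hΦ⟩ :=
      GNotch.exists_nearMin (fun Ψ : PeriodicTrialState N L => periodicEnergy v Ψ) hCρ
    have hsms : ∀ Ψ : PeriodicTrialState N L,
        (⨅ Ψ' : PeriodicTrialState N L, periodicEnergy v Ψ') + s * n Ψ ≤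
          periodicEnergy v Ψ + ENNReal.ofReal (C * ρ) :=
      fun Ψ => hN p hp Ψ
    have key := softenedNearMin_of_sms (fun Ψ : PeriodicTrialState N L => periodicEnergy v Ψ) n s
      (ENNReal.ofReal (C * ρ)) (ENNReal.ofReal (C * ρ)) Φ hinf hsms hΦ
    have hCC : ENNReal.ofReal (C * ρ) + ENNReal.ofReal (C * ρ) = ENNReal.ofReal ((C + C) * ρ) := by
      rw [← ENNReal.ofReal_add (by positivity) (by positivity)]
      congr 1; ring
    rw [hCC] at key
    exact ⟨Φ, key⟩
  · intro h v hv hint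
    obtain ⟨C, hC, ρ₀, hρ₀, hh⟩ := h v hv hint
    refine ⟨C + C, by positivity, ρ₀, hρ₀, fun ρ hρ hρ' => ?_⟩
    filter_upwards [hh ρ hρ hρ'] with N hN
    intro p hp
    set L : ℝ := sideLength ρ N with hL
    obtain ⟨Φ, hΦ, hnΦ⟩ := hN p hp
    intro Ψ
    show (⨅ Φ : PeriodicTrialState N L, periodicEnergy v Φ) +
        2⁻¹ * fracDispersion 2 L p * cellOccupation N L (planeWaveMode L p) Ψ.ψ ≤
        periodicEnergy v Ψ + ENNReal.ofReal ((C + C) * ρ)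
    have key := sms_of_softenedNearMin (fun Ψ : PeriodicTrialState N L => periodicEnergy v Ψ)
      (fun Φ : PeriodicTrialState N L => cellOccupation N L (planeWaveMode L p) Φ.ψ)
      (2⁻¹ * fracDispersion 2 L p) (ENNReal.ofReal (C * ρ)) (ENNReal.ofReal (C * ρ)) Φ hΦ hnΦ Ψ
    have hCC : ENNReal.ofReal (C * ρ) + ENNReal.ofReal (C * ρ) = ENNReal.ofReal ((C + C) * ρ) := by
      rw [← ENNReal.ofReal_add (by positivity) (by positivity)]
      congr 1; ring
    rw [hCC] at key
    exact key

end Summit.AtomisticToContinuum.BoseEinsteinCondensation.Theorems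

end
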